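import Summits.ResolutionOfSingularities.ResolutionOfSingularities.Theorems.LossEntryW02
import HarnessLib

/-!
# LossEntryW03 — walk plumbing of the loss→entry law `LawLossEntry`, part 3/11

decomp-res-lens-3, gen 29 (HOME/decomp-res-lens-3/g29/NODE-g29.md).  TOOL at 0 toward the residual item
stmt-ResolutionOfSingularities-27367 (`WallCut.NoLossyStrictTailsDeep` ⟸ `LossEpisode.LawLossEntry`).  Imports part 2 (`Theorems.LossEntryW02`, to be landed first).

Contents: §5 KEY OBSERVATION `resPoint_chartExponent_eq_entryPt`, §6 `polyPts_succ_loss_b`, `exists_axisWitness_loss_b`, LAW `lawLossEntryAt_of_loss_b`.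
-/

open MvPolynomial Finset
open Literature.AlgebraicGeometry.Resolution
open Literature.AlgebraicGeometry.Resolution.Hauser2010
open Literature.AlgebraicGeometry.Resolution.PointBlowup
open Summit.ResolutionOfSingularities.ResolutionOfSingularities.Theorems.TightDefectClasses
open Summit.ResolutionOfSingularities.ResolutionOfSingularities.Theorems.TightDefectStrongWalks
open Summit.ResolutionOfSingularities.ResolutionOfSingularities.Theorems.ItineraryCutClasses
open Summit.ResolutionOfSingularities.ResolutionOfSingularities.Theorems.BoundaryLedger
open Summit.ResolutionOfSingularities.ResolutionOfSingularities.Theorems.ProximityCut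
open Summit.ResolutionOfSingularities.ResolutionOfSingularities.Theorems.LossIsFatalLayer (chartMap chartMap_X chartMap_X_self
  chartMap_X_ne chartMap_C)
open Summit.ResolutionOfSingularities.ResolutionOfSingularities.Theorems.LossExitCone
open Summit.ResolutionOfSingularities.ResolutionOfSingularities.Theorems.LossPolygon

/-! ## §5 KEY OBSERVATION: the polygon of the one-wall state after a (b)-loss IS the entry set -/

namespace Summit.ResolutionOfSingularities.ResolutionOfSingularities.Theorems.LossPolygon

variable {K : Type} [Field K] [DecidableEq K]
variable {q : ℕ}

/-- **POINTWISE (PROVED):** in the frame `(j, i ; l)` of the one-wall state `r₁ = T e_j` (`q + T = o`) the point of the chart image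
`chartExponent q j E` is the ENTRY POINT of `E`: `((deg E − o)/(s − E l), E i/(s − E l))`. [NODE-g29 KEY OBS; new] -/
theorem resPoint_chartExponent_eq_entryPt {i j l : Fin 3} (hij : i ≠ j) (hjl : j ≠ l) {s o T : ℕ}
    {r₁ : Fin 3 →₀ ℕ} (hr₁j : r₁ j = T) (hr₁i : r₁ i = 0) (hr₁l : r₁ l = 0) (hoT : q + T = o) {E : Fin 3 →₀ ℕ}
    (hqE : q ≤ E.degree) : resPoint s r₁ j i l (chartExponent q j E) = entryPt s o i l E := by
  have hxj : chartExponent q j E j = E.degree - q := by rw [chartExponent_apply, if_pos rfl]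
  have hxi : chartExponent q j E i = E i := by rw [chartExponent_apply, if_neg hij]
  have hxl : chartExponent q j E l = E l := by rw [chartExponent_apply, if_neg (Ne.symm hjl)]
  have hcast : (((E.degree - q : ℕ)) : ℚ) - ((T : ℕ) : ℚ) = ((E.degree : ℕ) : ℚ) - ((o : ℕ) : ℚ) := by
    rw [Nat.cast_sub hqE, ← hoT]; push_cast; ring
  refine Prod.ext ?_ ?_
  · simp only [resPoint, entryPt, hxj, hxl, hr₁j, hr₁l, Nat.cast_zero, add_zero]
    rw [hcast]
  · simp only [resPoint, entryPt, hxi, hxl, hr₁i, hr₁l, Nat.cast_zero, add_zero, sub_zero]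

end Summit.ResolutionOfSingularities.ResolutionOfSingularities.Theorems.LossPolygon

namespace Summit.ResolutionOfSingularities.ResolutionOfSingularities.Theorems.LossEpisode

variable {K : Type} [Field K] [DecidableEq K] {q : ℕ} {s₀ : State (Fin 3) K}

section WalkB

variable {W : ForcedWalk q s₀} {N s : ℕ}

/-- **THE ONE-WALL STATE'S POLYGON IS THE ENTRY SET (PROVED):** after a loss at `t` from the run state `(i,j,l;k,m)` in the
chart `j` of the loss wall, with new wall `r_{t+1} = T e_j` (`q + T = o = k + m + s`),
`polyPts s r_{t+1} (j, i ; l) F_{t+1} = entryPts s o i l (deletePthPowers q (σ_{i,j,b i} σ_{l,j,b l} F_t))`.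
[NODE-g29 KEY OBS (FACT 0 is `Ψ₍₀:₁₎` of it); CJS2020 §13 entry into the polygon, for the walk; new] -/
theorem polyPts_succ_loss_b (hroot : IsRoot q s₀) (t : ℕ) {i j l : Fin 3} {k m : ℕ}
    (hS : IsRunState W s t i j l k m) (hjt : W.j t = j) {T : ℕ} (hr1 : (W.st (t + 1)).r = Finsupp.single j T)
    (hTo : q + T = k + m + s) :
    polyPts s (W.st (t + 1)).r j i l (W.st (t + 1)).F =
      entryPts s (k + m + s) i l (deletePthPowers q (shear i j (W.b t i) (shear l j (W.b t l) (W.st t).F))) := by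
  classical
  have hij : i ≠ j := hS.1
  have hli : l ≠ i := hS.2.1
  have hlj : l ≠ j := hS.2.2.1
  have hr₁j : (W.st (t + 1)).r j = T := by rw [hr1, Finsupp.single_eq_same]
  have hr₁i : (W.st (t + 1)).r i = 0 := by rw [hr1, Finsupp.single_apply, if_neg hij.symm]
  have hr₁l : (W.st (t + 1)).r l = 0 := by rw [hr1, Finsupp.single_apply, if_neg (Ne.symm hlj)]
  have hsupp := support_succ_two_shears hroot W t hij hlj hli.symm hjt
  ext x
  simp only [polyPts, entryPts, Finset.mem_image, Finset.mem_filter]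
  constructor
  · rintro ⟨D, ⟨hD, hDl⟩, rfl⟩
    rw [hsupp, Finset.mem_image] at hD
    obtain ⟨E, hE, rfl⟩ := hD
    have hEsupp := (Finset.mem_filter.mp hE).1
    have hqE : q ≤ E.degree := le_degree_of_mem_support_two_shears hroot W t j i l _ _ hEsupp
    refine ⟨E, ⟨by rw [support_deletePthPowers']; exact hE, ?_⟩,
      (resPoint_chartExponent_eq_entryPt hij (Ne.symm hlj) hr₁j hr₁i hr₁l hTo hqE).symm⟩
    rw [chartExponent_apply, if_neg hlj, hr₁l, add_zero] at hDl
    exact hDl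
  · rintro ⟨E, ⟨hE, hEl⟩, rfl⟩
    rw [support_deletePthPowers'] at hE
    have hEsupp := (Finset.mem_filter.mp hE).1
    have hqE : q ≤ E.degree := le_degree_of_mem_support_two_shears hroot W t j i l _ _ hEsupp
    refine ⟨chartExponent q j E, ⟨?_, ?_⟩, resPoint_chartExponent_eq_entryPt hij (Ne.symm hlj) hr₁j hr₁i hr₁l hTo hqE⟩
    · rw [hsupp]; exact Finset.mem_image_of_mem _ hE
    · rw [chartExponent_apply, if_neg hlj, hr₁l, add_zero]; exact hEl

/-- **AXIS WITNESS TRANSPORTED (PROVED):** the `(j,l)`-axis law of `F_{t+1}` (`ConeCutAxisLaw.axis_law`) gives a monomial `u^R` of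
the cleaned prepared equation with `deg R + R l < 2q`, which lies below the ceiling `R l < s`. [new] -/
theorem exists_axisWitness_loss_b (hroot : IsRoot q s₀) (hT : TailHyp W N s) {t : ℕ} (hNt : N ≤ t) {i j l : Fin 3} {k m : ℕ}
    (hS : IsRunState W s t i j l k m) (hjt : W.j t = j) (hos : 2 * q + 1 ≤ k + m + s + s) :
    ∃ R ∈ (deletePthPowers q (shear i j (W.b t i) (shear l j (W.b t l) (W.st t).F))).support,
      R.degree + R l < 2 * q ∧ R l < s := by
  classical
  have hij : i ≠ j := hS.1
  have hli : l ≠ i := hS.2.1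
  have hlj : l ≠ j := hS.2.2.1
  obtain ⟨M, hM, hMjl⟩ := ConeCutAxisLaw.axis_law W (t + 1) j l (Ne.symm hlj)
  rw [support_succ_two_shears hroot W t hij hlj hli.symm hjt, Finset.mem_image] at hM
  obtain ⟨E, hE, rfl⟩ := hM
  have hEsupp := (Finset.mem_filter.mp hE).1
  have hqE : q ≤ E.degree := le_degree_of_mem_support_two_shears hroot W t j i l _ _ hEsupp
  have hoE : k + m + s ≤ E.degree := le_degree_of_mem_support_prepared hroot hT hNt hS _ _ hEsupp
  rw [chartExponent_apply, if_pos rfl, chartExponent_apply, if_neg hlj] at hMjl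
  refine ⟨E, by rw [support_deletePthPowers']; exact hE, by omega, by omega⟩

/-- **LAW (L_E), CASE (b) (PROVED): LOSS IN THE CHART OF THE LOSS WALL + REPEAT ⇒ THE NEXT RUN STATE HAS STRICTLY SMALLER `β`.**
From a heavy run state `(i,j,l;k,m)` (`q ≤ m + s`) on the tail, a loss at `t` in the chart `j` (`b_t(i) ≠ 0`) followed by a
proximity repeat lands at `t + 2` in the run state `(i, j, l ; d, T)` with
`β_{t+2} = α(EP) + β(EP) − 1 < β_t` — the repeat is the untranslated `u_i`-chart (`repeat_after_loss_b`), the polygon of the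
one-wall state is the entry set (`polyPts_succ_loss_b`), the repeat acts by `Ψ₍₀:₁₎` (`polyPts_succ_chart_snd`), and the entry law
`LossPolygon.entry_lt_betaOf_of_axisWitness` (T8b) bounds the result.  This is `LawLossEntryAt` for (b)-losses followed by a
repeat, with `u = t + 2`. [CJS2020 Lemma 13.4, case of a translated move, for the walk; new] -/
theorem lawLossEntryAt_of_loss_b (hroot : IsRoot q s₀) (hT : TailHyp W N s) {t : ℕ} (hNt : N ≤ t) {i j l : Fin 3}
    {k m : ℕ} (hS : IsRunState W s t i j l k m) (hm : q ≤ m + s) (hjt : W.j t = j) (hbi : W.b t i ≠ 0)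
    (hloss : IsLossMove W t) (hst : StaysOnNewest W t) :
    ∃ u : ℕ, t < u ∧ ∃ (i' j' l' : Fin 3) (k' m' : ℕ), IsRunState W s u i' j' l' k' m' ∧ q ≤ m' + s ∧
      runBeta W s u i' j' l' < runBeta W s t i j l := by
  classical
  obtain ⟨hord, hq, hks, hms, -⟩ := runState_ledger hroot hT hNt hS
  obtain ⟨hri, hrj, hrl⟩ := hS.r_apply
  have hij : i ≠ j := hS.1
  have hli : l ≠ i := hS.2.1
  have hlj : l ≠ j := hS.2.2.1
  have hsq : s < q := hT.s_lt
  have h1s : 1 ≤ s := hT.one_le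
  obtain ⟨T, hoT, h1T, hr1, hqT, hnext⟩ := lossMove_next hroot hT hNt hloss
  have hTo : q + T = k + m + s := by
    have h := hord.symm.trans hoT
    have h' : s + k + m = q + T := by exact_mod_cast h
    omega
  rcases hnext with ⟨hnst, -, -⟩ | ⟨-, l₂, d, hl₂i, hl₂j, hTd, h1d, hS2⟩
  · exact absurd hst hnst
  obtain ⟨hci, hb1⟩ := repeat_after_loss_b hroot hT hNt hS hjt hbi hloss hst
  rw [hci] at hS2 hl₂i
  rw [hjt] at hS2 hl₂j hr1
  have hl₂ : l₂ = l := by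
    rcases fin3_eq_or i j l l₂ hij hli.symm (Ne.symm hlj) with h | h | h
    · exact absurd h hl₂i
    · exact absurd h hl₂j
    · exact h
  rw [hl₂] at hS2
  have hS2' : IsRunState W s (t + 1 + 1) i j l d T := hS2
  refine ⟨t + 1 + 1, by omega, i, j, l, d, T, hS2', hqT.le, ?_⟩
  -- the two polygon identities
  obtain ⟨hr₂i, hr₂j, hr₂l⟩ := hS2'.r_apply
  have hr₁j : (W.st (t + 1)).r j = T := by rw [hr1, Finsupp.single_eq_same]
  have hr₁i : (W.st (t + 1)).r i = 0 := by rw [hr1, Finsupp.single_apply, if_neg hij.symm]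
  have hr₁l : (W.st (t + 1)).r l = 0 := by rw [hr1, Finsupp.single_apply, if_neg (Ne.symm hlj)]
  have hP2 : polyPts s (W.st (t + 1 + 1)).r j i l (W.st (t + 1 + 1)).F =
      (polyPts s (W.st (t + 1)).r j i l (W.st (t + 1)).F).image psi01 :=
    polyPts_succ_chart_snd hroot W (t + 1) hij.symm (Ne.symm hlj) (Ne.symm hli) hci hb1 (by rw [hr₂j, hr₁j])
      (by rw [hr₂i, hr₁j, hr₁i]; omega) hr₁l hr₂l
  have hP1 := polyPts_succ_loss_b hroot t hS hjt hr1 hTo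
  -- the entry law T8b and its binders
  have hos : 2 * q + 1 ≤ k + m + s + s := by omega
  obtain ⟨R, hR, hax, hRl⟩ := exists_axisWitness_loss_b hroot hT hNt hS hjt hos
  have hneEP : (entryPts s (k + m + s) i l
      (deletePthPowers q (shear i j (W.b t i) (shear l j (W.b t l) (W.st t).F)))).Nonempty :=
    ⟨_, entryPt_mem_entryPts _ _ _ _ _ hR hRl⟩
  have hqj : q ≤ s + (W.st t).r j := by rw [hrj]; omega
  have h8 := entry_lt_betaOf_of_axisWitness hij hli.symm (Ne.symm hlj) hrl hbi (W.b t l)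
    (fun D hD => not_isPthPowerExponent_of_mem_support hroot W t hD) (walk_r hroot W t)
    (fun D hD => by rw [hri, hrj]; exact le_degree_of_mem_support_runState hroot hT hNt hS hD)
    (polyPts_nonempty_of_heavy_fst hroot W t (Ne.symm hlj) i hqj hrl)
    (alphaOf_polyPts_lt_one hroot W t (Ne.symm hlj) i hqj hrl) hsq (by rw [hri, hrj]; omega) (by rw [hri, hrj]; omega)
    hR hax
  rw [hri, hrj] at h8
  unfold runBeta
  rw [hP2, betaOf_image_psi01 (by rw [hP1]; exact hneEP), hP1]
  exact h8

end WalkB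

end Summit.ResolutionOfSingularities.ResolutionOfSingularities.Theorems.LossEpisode
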